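import Mathlib.RingTheory.DedekindDomain.Ideal.Lemmas
import HarnessLib

/-!
# The 𝒪-scalar `u = p·b·b̄ ⁄ (a·ā)` of a conjugate pair of class relations: `u ∈ 𝔟·𝔟̄`, `ū = u`

Layer `Literature/NumberTheory/NumberFields`, namespace `Literature.NumberTheory.NumberFields`.  THEOREMS ONLY (no definition, no
named fact, no instance, no notation, no `sorry`).  Cell `hodgecm-mathlib` (D-0151), FLOOR-0 programme, crux `hLiu418`, D-line L3
socket `stub_ROOF0`, road (ρ-𝔟) — the XS number-theory bookkeeping row of LA3-plan (g0) RULING «DUAL-B̄» #7 (3) (the scalar of the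
twisted polarization `q^*λ_Q = ι(u) ≫ λ` of the (ρ-𝔟) roof, [MumfordAV1970] §20–§21, §23); author LA3-p03 (g2); count-neutral
capital (`--supports stmt-HodgeConjecture-24832`).  HC_CM is proved only modulo the 7 printed citations until rung 0 closes; nothing
in this file is about HC.

## Statement (generic: `O` a Dedekind domain, `c` a ring automorphism of `O` — for a CM field, complex conjugation on `𝓞 F`)

Let `(a)·𝔟 = (b)·𝔭` with `a ≠ 0` (two integral ideals in the same class, [Neukirch1999] I (3.8)–(3.9)) and `𝔭·c(𝔭)·𝔡 = (p)`
(`𝔭 · 𝔭̄` divides `(p)`).  Then there is `u ∈ O` with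
* `u · (a · c a) = p · (b · c b)` and `(u) = 𝔟 · c(𝔟) · 𝔡`, in particular `u ∈ 𝔟 · c(𝔟)` (`exists_scalar_of_span_mul_eq`);
* `c u = u` whenever `c` is an involution fixing `p` (`conj_scalar_eq_of_span_mul_eq`).
(Apply `c` to the class relation and multiply: `(a·c a)·𝔟·c(𝔟) = (b·c b)·𝔭·c(𝔭)`; times `𝔡`: `(a·c a)·(𝔟·c(𝔟)·𝔡) = (p·b·c b)`;
cancel the nonzero principal ideal `(a·c a)` in the Dedekind monoid of ideals, [Neukirch1999] I (3.8)–(3.9), [MilneANT2008] Thm. 3.7.)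

## References

* [Neukirch1999] J. Neukirch, *Algebraic Number Theory* (1999), Ch. I §3 (3.8)–(3.9) (unique factorisation ∕ cancellation of ideals).
* [MilneANT2008] J. S. Milne, *Algebraic Number Theory* (v3.08, 2008), Thm. 3.7 and Rem. 3.12.
* [MumfordAV1970] D. Mumford, *Abelian Varieties* (1970), §20 (pp. 184–189), §21, §23 (the Rosati scalar of a twisted polarization).
-/

set_option autoImplicit false

namespace Literature.NumberTheory.NumberFields

variable {O : Type*} [CommRing O] [IsDedekindDomain O] (c : O ≃+* O)

omit [IsDedekindDomain O] in
/-- Applying a ring automorphism to a class relation `(a)·𝔟 = (b)·𝔭`: `(c a)·c(𝔟) = (c b)·c(𝔭)`. [cite: Neukirch1999, Ch. I §3 (3.8)–(3.9)] -/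
theorem span_map_mul_map_eq_of_span_mul_eq {a b : O} {𝔟 𝔭 : Ideal O} (h : Ideal.span {a} * 𝔟 = Ideal.span {b} * 𝔭) :
    Ideal.span {c a} * 𝔟.map (c : O →+* O) = Ideal.span {c b} * 𝔭.map (c : O →+* O) := by
  have h' := congrArg (Ideal.map (c : O →+* O)) h
  simpa only [Ideal.map_mul, Ideal.map_span, Set.image_singleton, RingHom.coe_coe] using h'

/-- **THE SCALAR `u = p·b·b̄ ⁄ (a·ā)`**: from `(a)·𝔟 = (b)·𝔭`, `a ≠ 0`, and `𝔭·c(𝔭)·𝔡 = (p)` there is `u ∈ O` with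
`u·(a·c a) = p·(b·c b)`, `(u) = 𝔟·c(𝔟)·𝔡`, hence `u ∈ 𝔟·c(𝔟)`. [cite: Neukirch1999, Ch. I §3 (3.8)–(3.9)] [cite: MilneANT2008, Thm. 3.7] -/
theorem exists_scalar_of_span_mul_eq {a b p : O} (ha : a ≠ 0) {𝔟 𝔭 𝔡 : Ideal O}
    (h : Ideal.span {a} * 𝔟 = Ideal.span {b} * 𝔭) (hp : 𝔭 * 𝔭.map (c : O →+* O) * 𝔡 = Ideal.span {p}) :
    ∃ u : O, u * (a * c a) = p * (b * c b) ∧ Ideal.span {u} = 𝔟 * 𝔟.map (c : O →+* O) * 𝔡 ∧ u ∈ 𝔟 * 𝔟.map (c : O →+* O) := by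
  have hc := span_map_mul_map_eq_of_span_mul_eq c h
  -- `(a·c a)·(𝔟·c(𝔟)·𝔡) = (p·(b·c b))`
  have hprod : Ideal.span {a * c a} * (𝔟 * 𝔟.map (c : O →+* O) * 𝔡) = Ideal.span {p * (b * c b)} := by
    calc Ideal.span {a * c a} * (𝔟 * 𝔟.map (c : O →+* O) * 𝔡)
        = (Ideal.span {a} * 𝔟) * (Ideal.span {c a} * 𝔟.map (c : O →+* O)) * 𝔡 := by
          rw [← Ideal.span_singleton_mul_span_singleton]; ring
      _ = (Ideal.span {b} * 𝔭) * (Ideal.span {c b} * 𝔭.map (c : O →+* O)) * 𝔡 := by rw [h, hc]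
      _ = Ideal.span {b * c b} * (𝔭 * 𝔭.map (c : O →+* O) * 𝔡) := by
          rw [← Ideal.span_singleton_mul_span_singleton]; ring
      _ = Ideal.span {p * (b * c b)} := by rw [hp, Ideal.span_singleton_mul_span_singleton, mul_comm]
  -- `p·b·c b ∈ (a·c a)`, so `p·b·c b = u·(a·c a)`
  have hmem : p * (b * c b) ∈ Ideal.span {a * c a} :=
    Ideal.mul_le_right (hprod.symm ▸ Ideal.mem_span_singleton_self (p * (b * c b)))
  obtain ⟨u, hu⟩ := Ideal.mem_span_singleton'.mp hmem
  have haca : a * c a ≠ 0 := mul_ne_zero ha (by rw [Ne, EmbeddingLike.map_eq_zero_iff]; exact ha)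
  have hspan : Ideal.span {u} = 𝔟 * 𝔟.map (c : O →+* O) * 𝔡 := by
    have h2 : Ideal.span {a * c a} * Ideal.span {u} = Ideal.span {a * c a} * (𝔟 * 𝔟.map (c : O →+* O) * 𝔡) := by
      rw [hprod, Ideal.span_singleton_mul_span_singleton, mul_comm (a * c a) u, hu]
    exact mul_left_cancel₀ ((Ideal.span_singleton_eq_bot.not).mpr haca) h2
  refine ⟨u, hu, hspan, ?_⟩
  exact Ideal.mul_le_right (hspan ▸ Ideal.mem_span_singleton_self u)

/-- **`ū = u`**: if moreover `c` is an involution with `c p = p`, the scalar is `c`-invariant (`c u·(c a·a) = p·(c b·b) = u·(a·c a)` and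
`a·c a ≠ 0`). [cite: Neukirch1999, Ch. I §3 (3.8)–(3.9)] -/
theorem conj_scalar_eq_of_mul_eq (hc : ∀ x, c (c x) = x) {a b p u : O} (ha : a ≠ 0) (hcp : c p = p)
    (hu : u * (a * c a) = p * (b * c b)) : c u = u := by
  have haca : a * c a ≠ 0 := mul_ne_zero ha (by rw [Ne, EmbeddingLike.map_eq_zero_iff]; exact ha)
  have h1 : c u * (a * c a) = u * (a * c a) := by
    have h2 := congrArg c hu
    rw [map_mul, map_mul, map_mul, map_mul, hc, hc, hcp, mul_comm (c a) a, mul_comm (c b) b] at h2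
    rw [hu]
    exact h2
  exact mul_right_cancel₀ haca h1

/-- The two rows packaged: `∃ u, u·(a·c a) = p·(b·c b) ∧ u ∈ 𝔟·c(𝔟) ∧ c u = u`. [cite: Neukirch1999, Ch. I §3 (3.8)–(3.9)] [cite: MilneANT2008, Thm. 3.7] -/
theorem exists_conj_invariant_scalar_of_span_mul_eq (hc : ∀ x, c (c x) = x) {a b p : O} (ha : a ≠ 0) (hcp : c p = p)
    {𝔟 𝔭 𝔡 : Ideal O} (h : Ideal.span {a} * 𝔟 = Ideal.span {b} * 𝔭) (hp : 𝔭 * 𝔭.map (c : O →+* O) * 𝔡 = Ideal.span {p}) :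
    ∃ u : O, u * (a * c a) = p * (b * c b) ∧ u ∈ 𝔟 * 𝔟.map (c : O →+* O) ∧ c u = u := by
  obtain ⟨u, hu, -, hmem⟩ := exists_scalar_of_span_mul_eq c ha h hp
  exact ⟨u, hu, hmem, conj_scalar_eq_of_mul_eq c hc ha hcp hu⟩

end Literature.NumberTheory.NumberFields
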